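import Summits.AnomalousDissipation.AnomalousDissipation.Theorems.MarginalStabilityChainStrainedLayerLawClockMemberTransfer
import Summits.AnomalousDissipation.AnomalousDissipation.Theorems.MarginalStabilityChainStrainedLayerLawParallelRelaxMeanDissipation
import Summits.AnomalousDissipation.AnomalousDissipation.Theorems.MarginalStabilityChainStrainedLayerLawParallelRelaxStubCaloricTails
import Summits.AnomalousDissipation.AnomalousDissipation.Theorems.MarginalStabilityChainStrainedLayerLawParallelRelaxShearTails
import HarnessLib

/-!
# Crux `MarginalStabilityChain.StrainedLayerLaw` (stmt-AnomalousDissipation-3007), line `FirstLemmasR2K4`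
# (log-enstrophy clock + Nash roundness): THE ROUNDNESS FLOOR CANNOT BE WITNESSED BY x-INDEPENDENT PERTURBATIONS

Support file (`--supports stmt-AnomalousDissipation-3007`; registered sub-goal `roundnessFloor_xIndependent_false`).
Line lead c6 (`prover-line-stmt-AnomalousDissipation-3007-c6-0`, 2026-08-17). It assembles the five sub-goals of the
lead's wave 1 — `stub_strainedCaloricTails` (p131798: uniform exponential bounds for the strained caloric function
`(e^{s(t)Δ}g)(eᵗy)` and its `y`, `yy`, `t` derivatives on compact time ranges), `hasShearLayerTails_parallelMember`
(p131735: the explicit parallel member `U_B^ν + P`, `v = p = 0`, of `…ParallelRelaxMember.lean` lies in the REPAIRED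
class `HasShearLayerTails`), `meanLayerDissipation_floor_of_eventuallyRound` (p131619: the clock composition PER MEMBER —
eventual Nash roundness with constant `r₀` along one tailed classical solution forces
`ofReal (r₀L/4) ≤ meanLayerDissipation`), `parallelMember_finiteDissipation` and `meanLayerDissipation_parallelMember`
(p131657: the member's dissipation is locally finite and its Cesàro mean is EXACTLY the Sweet–Parker rung
`ofReal (√ν/(2√π))`) — into

* `roundnessFloor_xIndependent_false` (REGISTERED NEGATIVE): the line's one open dynamical stub `stub_roundnessFloor`
  (B3: `∃ r > 0 ∀ L ∃ ν₀ ∃ θ admissible ∀ ν ≤ ν₀ ∀` finite-dissipation tailed members: eventually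
  `(r·min(L,1)/L)·M₋²P₋ ≤ Ω₋²`) with its `∃ θ` restricted by the extra clause `∀ x y, θ₁ x y = θ₁ 0 y ∧ θ₂ x y = θ₂ 0 y`
  is FALSE for every `r` — UNCONDITIONALLY (no hygiene hypothesis: the tails of the witness member are verified, not
  assumed). Proof: at `L = 1`, `ν = min ν₀ (πr²/16)` the parallel member is in the class (`inCruxClass_parallel`), has
  locally finite dissipation and shear tails, so B3 would make it eventually round with `r₀ = r`; the per-member clock
  transfer then gives mean dissipation `≥ r/4`, whereas it is `√ν/(2√π) ≤ r/8`.

Together with `roundnessFloor_theta_zero_false` (p127935, θ = 0) and the crux-level `strainedLayerLaw_xIndependent_false`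
(p130190) this certifies in the tree that the witness `θ` of B3 must depend on `x`: Nash roundness of `ω₋` has to be
CREATED by x-dependent (Kelvin–Helmholtz) roll-up; no parallel datum relaxes to anything but the flat sheet. It also
shows that the x-independent negatives survive the recommended class repair (`HasShearLayerTails` appended to 3007's
class): the relaxing family lies in the repaired class.

No definitions, no facts asserted. References: Majda–Bertozzi 2002 §1.4 (1.34) (the strained shear-diffusion family);
the disprover's workfile `Cruxes/StrainedLayerLaw/Disproof.lean` §2/§4; tree files named above.
-/

-- `Summit.<Summit>.<Problem>` is the tree's mandated summit-side namespace (CONVENTIONS §2); for this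
-- single-conjunct summit the two coincide, so the duplicate is deliberate.
set_option linter.dupNamespace false

noncomputable section

open scoped Topology ENNReal
open Filter Set Function MeasureTheory

namespace Summit.AnomalousDissipation.AnomalousDissipation.Theorems.StrainedLayerLaw.LogEnstrophyClock

open Literature.Analysis.FluidPDE Literature.Analysis.FluidPDE.StretchedLayer
open Literature.Analysis.UnboundedOperators
open Summit.AnomalousDissipation.AnomalousDissipation.Theses.MarginalStabilityChain
open Summit.AnomalousDissipation.AnomalousDissipation.Theorems.StrainedLayerLaw.StrainWorkSumRule
open Summit.AnomalousDissipation.AnomalousDissipation.Theorems.StrainedLayerLaw.ParallelRelax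

/-- **Shear tails of the parallel member on compact time ranges** (the line's `ExpTails` form): for `ν > 0` and
`g ∈ C²_c(ℝ)`, the parallel member `u = U_B^ν + P`, `v = 0` has uniform exponential shear tails on every
`[a, b] ⊂ (0, ∞)` — `hasShearLayerTails_parallelMember` fed with `stub_strainedCaloricTails`, read through the landed
glue `expTails_of_hasShearLayerTails`. [folklore] -/
theorem expTails_parallelMember {ν : ℝ} {g : ℝ → ℝ} (hν : 0 < ν) (hg : ContDiff ℝ 2 g)
    (hc : HasCompactSupport g) :
    ∀ a b : ℝ, 0 < a → a < b →
      ExpTails (Icc a b)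
        (fun t (_ : ℝ) y => burgersLayerProfile 1 ν 1 y +
          ∫ z, heatKernel 1 z * g (Real.exp t * y - Real.sqrt (ν * (Real.exp (2 * t) - 1) / 2) * z))
        (fun _ _ _ => 0) :=
  fun _ _ ha hab =>
    expTails_of_hasShearLayerTails (hasShearLayerTails_parallelMember stub_strainedCaloricTails ν g hν hg hc) ha hab.le

/-- **The roundness floor restricted to x-independent perturbations is FALSE (registered negative, unconditional).**
`stub_roundnessFloor` with the extra clause "`θ` does not depend on `x`" fails for every `r > 0`: at `L = 1` and
`ν = min ν₀ (πr²/16)` the explicit parallel member `U_B^ν + P` (`inCruxClass_parallel`) has locally finite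
dissipation (`parallelMember_finiteDissipation`) and shear tails (`expTails_parallelMember`), so the restricted floor
would make it eventually Nash-round with constant `r`; the per-member clock transfer
(`meanLayerDissipation_floor_of_eventuallyRound`) then forces `ofReal (r/4) ≤ meanLayerDissipation`, while
`meanLayerDissipation_parallelMember` computes the mean as `ofReal (√ν/(2√π)) ≤ ofReal (r/8)`. Hence the witness `θ`
of B3 (as of the crux, p130190) must depend on `x`. [folklore] -/
theorem roundnessFloor_xIndependent_false :
    ¬ ∃ r : ℝ, 0 < r ∧ ∀ L : ℝ, 0 < L → ∃ ν₀ : ℝ, 0 < ν₀ ∧ ∃ θ₁ θ₂ : ℝ → ℝ → ℝ,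
      IsAdmissible L θ₁ θ₂ ∧ (∀ x y, θ₁ x y = θ₁ 0 y ∧ θ₂ x y = θ₂ 0 y) ∧
      ∀ ν : ℝ, 0 < ν → ν ≤ ν₀ → ∀ (u v p : ℝ → ℝ → ℝ → ℝ), InCruxClass ν L θ₁ θ₂ u v p →
        (∀ T : ℝ, 0 < T → ∫⁻ t in Ioc 0 T, layerDissipation ν L (u t) (v t) ≠ ∞) →
        (∀ a b : ℝ, 0 < a → a < b → ExpTails (Icc a b) u v) →
          ∃ T₁ : ℝ, 0 < T₁ ∧ ∀ t : ℝ, T₁ ≤ t →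
            r * min L 1 / L * negMass L (u t) (v t) ^ 2 * negPalinstrophy L (u t) (v t) ≤
              negEnstrophy L (u t) (v t) ^ 2 := by
  rintro ⟨r, hr, h⟩
  obtain ⟨ν₀, hν₀, θ₁, θ₂, hθ, hx, hall⟩ := h 1 one_pos
  -- the x-independent admissible perturbation is `(g(y), 0)` with `g ∈ C²_c`
  obtain ⟨hθ₂, hg, hc⟩ := stub_parallelClassTools.1 1 θ₁ θ₂ hθ hx
  set g : ℝ → ℝ := θ₁ 0 with hgdef
  have hθ₁ : θ₁ = fun _ y => g y := funext fun x => funext fun y => (hx x y).1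
  have hθ₂' : θ₂ = fun _ _ => 0 := funext fun x => funext fun y => hθ₂ x y
  -- a small viscosity: `ν ≤ ν₀` and `√ν/(2√π) ≤ r/8`
  set ν : ℝ := min ν₀ (Real.pi * r ^ 2 / 16) with hνdef
  have hν : 0 < ν := lt_min hν₀ (by positivity)
  have hνle : ν ≤ ν₀ := min_le_left _ _
  -- the parallel member, its finite dissipation and its shear tails
  set u : ℝ → ℝ → ℝ → ℝ := fun t _ y => burgersLayerProfile 1 ν 1 y +
    ∫ z, heatKernel 1 z * g (Real.exp t * y - Real.sqrt (ν * (Real.exp (2 * t) - 1) / 2) * z) with hudef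
  have hmem : InCruxClass ν 1 θ₁ θ₂ u (fun _ _ _ => 0) (fun _ _ _ => 0) := by
    rw [hθ₁, hθ₂']
    exact inCruxClass_parallel hν 1 hg hc
  have hfin : ∀ T : ℝ, 0 < T →
      ∫⁻ t in Ioc 0 T, layerDissipation ν 1 (u t) ((fun _ _ _ => (0:ℝ)) t) ≠ ∞ :=
    fun T hT => parallelMember_finiteDissipation ν 1 g hν one_pos hg hc T hT
  have htails : ∀ a b : ℝ, 0 < a → a < b → ExpTails (Icc a b) u (fun _ _ _ => 0) :=
    expTails_parallelMember hν hg hc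
  -- eventual roundness from the hypothesis, then the per-member clock transfer
  obtain ⟨T₁, hT₁, hround⟩ := hall ν hν hνle u _ _ hmem hfin htails
  have hr₀ : 0 < r * min 1 1 / 1 := by rw [min_self, div_one, mul_one]; exact hr
  have hfloor := meanLayerDissipation_floor_of_eventuallyRound ν 1 (r * min 1 1 / 1) hν one_pos hr₀ u _ _
    hmem.isSolution htails ⟨T₁, hT₁, hround⟩
  rw [meanLayerDissipation_parallelMember ν 1 g hν one_pos hg hc, min_self, div_one, mul_one, mul_one,
    ENNReal.ofReal_le_ofReal_iff (by positivity)] at hfloor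
  -- `r/4 ≤ √ν/(2√π) ≤ r/8`: contradiction
  have hsπ : 0 < Real.sqrt Real.pi := Real.sqrt_pos.2 Real.pi_pos
  have h1 : Real.sqrt ν ≤ Real.sqrt (Real.pi * r ^ 2 / 16) := Real.sqrt_le_sqrt (min_le_right _ _)
  have h2 : Real.sqrt (Real.pi * r ^ 2 / 16) = Real.sqrt Real.pi * r / 4 := by
    rw [show Real.pi * r ^ 2 / 16 = Real.pi * (r / 4) ^ 2 by ring, Real.sqrt_mul Real.pi_pos.le,
      Real.sqrt_sq (by positivity)]
    ring
  have h3 : Real.sqrt ν / (2 * Real.sqrt Real.pi) ≤ r / 8 := by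
    rw [div_le_iff₀ (by positivity)]; nlinarith
  linarith

end Summit.AnomalousDissipation.AnomalousDissipation.Theorems.StrainedLayerLaw.LogEnstrophyClock

end
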